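import Mathlib.MeasureTheory.Integral.Lebesgue.Add
import Mathlib.MeasureTheory.Measure.Typeclasses.Probability
import Mathlib.MeasureTheory.Constructions.BorelSpace.Real
import Mathlib.Analysis.SpecialFunctions.Exp
import Mathlib.Analysis.Complex.ExponentialBounds
import Mathlib.Analysis.SpecificLimits.Basic
import Mathlib.Data.Nat.Choose.Bounds
import Mathlib.Data.Nat.Log
import HarnessLib

/-!
# `TransferActivityTails` (stmt-AtomisticToContinuum-16624), line `Sketch` (heavy-block-pattern-cost):
stub `stub_patternCostEngine` — the abstract "pattern cost ⇒ law of large numbers" engine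

Pure probability and combinatorics, Mathlib only; nothing here is specific to hard spheres.  Setting: a
probability space, nonnegative blocks `X 0, …, X (K-1)`, a level `y₀ > 0`, and an exponential COST PER HEAVY
BLOCK uniform over temporal patterns on the dyadic ladder, `P (X j > y₀ 2^m ∀ j ∈ S) ≤ exp (-(c₀ + 2m)|S|)`
(`S ⊆ Fin K` nonempty, `m : ℕ`, `c₀ ≥ 3`).  Conclusion: for `K ≥ K₀(c₀, η)` (depending on `(c₀, η)` ONLY),
`E[ā 𝟙{ā > 8 y₀}] ≤ M' η + δ'` for `ā = K⁻¹ Σ_{j<K} X j` whenever `Σ_j E (X j - M')₊ ≤ K δ'`.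

Proof (constants with slack).  (1) Deterministic (`layerCake`, `sum_le_of_counts`): the dyadic layer cake
`x ≤ y₀ + Σ_{m<M} y₀ 2^m 𝟙{x > y₀ 2^m}` summed over blocks gives, on the GOOD event
`{∀ m, #{j : X j > y₀ 2^m} ≤ K / 4^m}`, `Σ_j X j ≤ K y₀ (1 + Σ_m 2^{-m}) ≤ 3 K y₀`; so, counts being monotone
in `m`, `{ā > 8 y₀} ⊆ ⋃_{m<L} {#_m ≥ K/4^m + 1} ∪ {#_L ≥ 1}` for any `L`.  (2) Pattern counting
(`measure_heavyCount_ge_le`): `{#_m ≥ n} ⊆ ⋃_{|S| = n} {∀ j ∈ S, X j > y₀ 2^m}`, so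
`P (#_m ≥ n) ≤ C(K,n) e^{-(c₀+2m) n}`.  (3) Numerics (`choose_mul_exp_le`, `rate_bound`): with
`n = K/4^m + 1 > K e^{-2m}` and `C(K,n) ≤ (eK/n)^n`, `C(K,n) e^{-(c₀+2m)n} ≤ e^{-2n}`; with `L = ⌊log_5 K⌋`
every `m < L` has `n ≥ 4 (5/4)^L` and the tail costs `K e^{-c₀-2L} ≤ 5e^{-3}(5e^{-2})^L`; in total
`P (ā > 8 y₀) ≤ L e^{-8 (5/4)^L} + 5e^{-3}(5e^{-2})^L ≤ 2 (5/7)^L ≤ η` once `K ≥ K₀ := 5^{m₀(η)}`.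
(4) `ā 𝟙{ā > 8y₀} ≤ M' 𝟙{ā > 8 y₀} + K⁻¹ Σ_j (X j - M')₊` pointwise; integrate.  No new definitions.
-/

noncomputable section

open MeasureTheory
open scoped ENNReal BigOperators

namespace Summit.AtomisticToContinuum.HydrodynamicLimit.Theorems.TransferActivityTailsPatternCostEngine

/-! ### §1 Deterministic layer: dyadic layer cake and the good-event bound -/

/-- **Dyadic layer cake.** For `y₀ > 0` and `x ≤ y₀ 2^M`: `x ≤ y₀ + Σ_{m<M} y₀ 2^m 𝟙{y₀ 2^m < x}`
(if `y₀ 2^k < x ≤ y₀ 2^{k+1}` the right-hand side is `y₀ 2^{k+1}`).  Induction on `M`. -/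
theorem layerCake {y₀ : ℝ} (hy : 0 < y₀) (M : ℕ) : ∀ x : ℝ, x ≤ y₀ * 2 ^ M →
    x ≤ y₀ + ∑ m ∈ Finset.range M, if y₀ * 2 ^ m < x then y₀ * 2 ^ m else 0 := by
  induction M with
  | zero => intro x hx; simpa using hx
  | succ M ih =>
    intro x hx
    rw [Finset.sum_range_succ]
    by_cases hM : y₀ * 2 ^ M < x
    · have hall : ∀ m ∈ Finset.range M, (if y₀ * 2 ^ m < x then y₀ * 2 ^ m else 0) = y₀ * 2 ^ m := fun m hm =>
        if_pos ((mul_le_mul_of_nonneg_left (pow_le_pow_right₀ one_le_two (Finset.mem_range.1 hm).le) hy.le).trans_lt hM)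
      have hgeom : ∑ m ∈ Finset.range M, (2 : ℝ) ^ m = 2 ^ M - 1 := by rw [geom_sum_eq (by norm_num)]; ring
      rw [if_pos hM, Finset.sum_congr rfl hall, ← Finset.mul_sum, hgeom]
      rw [pow_succ] at hx
      have hid : y₀ + y₀ * (2 ^ M - 1) + y₀ * 2 ^ M = y₀ * (2 ^ M * 2) := by ring
      linarith
    · rw [if_neg hM]
      have := ih x (not_lt.1 hM)
      linarith

/-- **Good-event bound.** If nonnegative reals `x : Fin K → ℝ` satisfy `#{j : y₀ 2^m < x j} ≤ K / 4^m`
(natural division) for EVERY `m`, then `Σ_j x j ≤ 3 K y₀`: sum the layer cake over `j`, swap the sums, use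
`2^m · (K / 4^m) ≤ K 2^{-m}` and `Σ_m 2^{-m} ≤ 2`. -/
theorem sum_le_of_counts {y₀ : ℝ} (hy : 0 < y₀) {K : ℕ} (x : Fin K → ℝ) (hx : ∀ j, 0 ≤ x j)
    (h : ∀ m : ℕ, (Finset.univ.filter fun j : Fin K => y₀ * 2 ^ m < x j).card ≤ K / 4 ^ m) :
    ∑ j, x j ≤ 3 * K * y₀ := by
  obtain ⟨M, hM⟩ : ∃ M : ℕ, ∑ j, x j ≤ y₀ * 2 ^ M := by
    obtain ⟨M, hM⟩ := pow_unbounded_of_one_lt ((∑ j, x j) / y₀) (by norm_num : (1 : ℝ) < 2)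
    exact ⟨M, by rw [div_lt_iff₀ hy] at hM; linarith⟩
  have hxM : ∀ j, x j ≤ y₀ * 2 ^ M := fun j => (Finset.single_le_sum (fun i _ => hx i) (Finset.mem_univ j)).trans hM
  have hcount : ∀ m : ℕ, (∑ j : Fin K, if y₀ * 2 ^ m < x j then y₀ * 2 ^ m else 0) ≤ K * y₀ * (1 / 2) ^ m := by
    intro m
    rw [← Finset.sum_filter, Finset.sum_const, nsmul_eq_mul]
    have hc : ((Finset.univ.filter fun j : Fin K => y₀ * 2 ^ m < x j).card : ℝ) ≤ K / 4 ^ m := by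
      refine le_trans (b := ((K / 4 ^ m : ℕ) : ℝ)) (by exact_mod_cast h m) ?_
      have := Nat.cast_div_le (m := K) (n := 4 ^ m) (α := ℝ)
      push_cast at this
      exact this
    calc ((Finset.univ.filter fun j : Fin K => y₀ * 2 ^ m < x j).card : ℝ) * (y₀ * 2 ^ m)
        ≤ K / 4 ^ m * (y₀ * 2 ^ m) := by gcongr
      _ = K * y₀ * (1 / 2) ^ m := by
        rw [show (4 : ℝ) ^ m = 2 ^ m * 2 ^ m by rw [← mul_pow]; norm_num, one_div, inv_pow]
        field_simp
  calc ∑ j, x j ≤ ∑ j : Fin K, (y₀ + ∑ m ∈ Finset.range M, if y₀ * 2 ^ m < x j then y₀ * 2 ^ m else 0) :=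
        Finset.sum_le_sum fun j _ => layerCake hy M (x j) (hxM j)
    _ = K * y₀ + ∑ m ∈ Finset.range M, ∑ j : Fin K, (if y₀ * 2 ^ m < x j then y₀ * 2 ^ m else 0) := by
        rw [Finset.sum_add_distrib, Finset.sum_const, Finset.card_univ, Fintype.card_fin, nsmul_eq_mul, Finset.sum_comm]
    _ ≤ K * y₀ + ∑ m ∈ Finset.range M, K * y₀ * (1 / 2 : ℝ) ^ m := by
        gcongr with m _
        exact hcount m
    _ = K * y₀ + K * y₀ * ∑ m ∈ Finset.range M, (1 / 2 : ℝ) ^ m := by rw [Finset.mul_sum]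
    _ ≤ K * y₀ + K * y₀ * 2 := by
        gcongr
        exact sum_geometric_two_le M
    _ = 3 * K * y₀ := by ring

/-! ### §2 Numerics: the binomial-exponential estimate and the final rate -/

/-- `C(K,n) ≤ (e K / n)^n` for `n ≠ 0`, from `C(K,n) ≤ K^n / n!` (`Nat.choose_le_pow_div`) and
`n^n / n! ≤ e^n` (`Real.pow_div_factorial_le_exp`). -/
theorem choose_le_exp_mul_div_pow (K n : ℕ) (hn : n ≠ 0) : (K.choose n : ℝ) ≤ (Real.exp 1 * K / n) ^ n := by
  have hnpos : (0 : ℝ) < n := by positivity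
  have h2 : (n : ℝ) ^ n / (n.factorial : ℝ) ≤ Real.exp n := Real.pow_div_factorial_le_exp (n : ℝ) (Nat.cast_nonneg n) n
  have hfact : (0 : ℝ) < (n.factorial : ℝ) := by positivity
  have hexpn : Real.exp (n : ℝ) = Real.exp 1 ^ n := by rw [← Real.exp_nat_mul, mul_one]
  calc (K.choose n : ℝ) ≤ (K : ℝ) ^ n / (n.factorial : ℝ) := Nat.choose_le_pow_div n K
    _ = (K / n : ℝ) ^ n * ((n : ℝ) ^ n / (n.factorial : ℝ)) := by rw [div_pow]; field_simp
    _ ≤ (K / n : ℝ) ^ n * Real.exp n := by gcongr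
    _ = (Real.exp 1 * K / n) ^ n := by rw [hexpn, ← mul_pow]; ring

/-- **Binomial regime.** For `c₀ ≥ 3`, `n ≠ 0` and `K ≤ 4^m n`: `C(K,n) exp (-(c₀+2m) n) ≤ exp (-2n)`.
Indeed `C(K,n) e^{-(c₀+2m)n} ≤ (e K e^{-(c₀+2m)} / n)^n` and `e K e^{-c₀-2m} ≤ K e^{-2} 4^{-m} ≤ e^{-2} n`
(`e^{1-c₀} ≤ e^{-2}`, `e^{-2} ≤ 1/4`). -/
theorem choose_mul_exp_le {c₀ : ℝ} (hc : 3 ≤ c₀) (K n m : ℕ) (hn : n ≠ 0) (hK : (K : ℝ) ≤ 4 ^ m * n) :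
    (K.choose n : ℝ) * Real.exp (-((c₀ + 2 * m) * n)) ≤ Real.exp (-(2 * n)) := by
  have hnpos : (0 : ℝ) < n := by positivity
  set p : ℝ := Real.exp (-(c₀ + 2 * m)) with hp
  have hp0 : 0 < p := Real.exp_pos _
  have hpn : Real.exp (-((c₀ + 2 * m) * n)) = p ^ n := by rw [hp, ← Real.exp_nat_mul]; congr 1; ring
  have h2n : Real.exp (-(2 * (n : ℝ))) = Real.exp (-2) ^ n := by rw [← Real.exp_nat_mul]; congr 1; ring
  have he2 : Real.exp (-2) ≤ (4 : ℝ)⁻¹ := by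
    rw [Real.exp_neg, inv_le_inv₀ (Real.exp_pos _) (by norm_num)]
    have h := Real.add_one_le_exp (1 : ℝ)
    have h22 : Real.exp 2 = Real.exp 1 * Real.exp 1 := by rw [← Real.exp_add]; norm_num
    rw [h22]
    nlinarith [Real.exp_pos (1 : ℝ)]
  have he2m : Real.exp (-(2 * (m : ℝ))) ≤ ((4 : ℝ) ^ m)⁻¹ := by
    rw [show (-(2 * (m : ℝ))) = m * (-2) by ring, Real.exp_nat_mul, ← inv_pow]
    exact pow_le_pow_left₀ (Real.exp_pos _).le he2 m
  have hbase : Real.exp 1 * K * p / n ≤ Real.exp (-2) := by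
    rw [div_le_iff₀ hnpos]
    have hep : Real.exp 1 * p ≤ Real.exp (-2) * ((4 : ℝ) ^ m)⁻¹ := by
      have hsplit : Real.exp 1 * p = Real.exp (1 - c₀) * Real.exp (-(2 * (m : ℝ))) := by
        rw [hp, ← Real.exp_add, ← Real.exp_add]; congr 1; ring
      rw [hsplit]
      exact mul_le_mul (Real.exp_le_exp.2 (by linarith)) he2m (Real.exp_pos _).le (Real.exp_pos _).le
    calc Real.exp 1 * K * p = K * (Real.exp 1 * p) := by ring
      _ ≤ K * (Real.exp (-2) * ((4 : ℝ) ^ m)⁻¹) := by gcongr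
      _ ≤ (4 ^ m * n) * (Real.exp (-2) * ((4 : ℝ) ^ m)⁻¹) := by gcongr
      _ = Real.exp (-2) * n := by field_simp
  rw [hpn, h2n]
  calc (K.choose n : ℝ) * p ^ n ≤ (Real.exp 1 * K / n) ^ n * p ^ n := by gcongr; exact choose_le_exp_mul_div_pow K n hn
    _ = (Real.exp 1 * K * p / n) ^ n := by rw [← mul_pow]; ring
    _ ≤ Real.exp (-2) ^ n := pow_le_pow_left₀ (by positivity) hbase n

/-- **Final rate.** `L e^{-8 (5/4)^L} + 5 e^{-3} (5 e^{-2})^L ≤ 2 (5/7)^L` for every `L : ℕ`: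
`(5/4)^L ≥ 1 + L/4` (Bernoulli), `L e^{-L} ≤ 1`, `e^{-1} ≤ 5/7`, `5 e^{-2} ≤ 5/7` (`e > 2.718`), `e^{-3} ≤ 1/8`. -/
theorem rate_bound (L : ℕ) :
    (L : ℝ) * Real.exp (-(8 * (5 / 4 : ℝ) ^ L)) + 5 * Real.exp (-3) * (5 * Real.exp (-2)) ^ L ≤ 2 * (5 / 7 : ℝ) ^ L := by
  have he1 : (2 : ℝ) ≤ Real.exp 1 := by have := Real.add_one_le_exp (1 : ℝ); norm_num at this; exact this
  have hd9 : (2.7182818283 : ℝ) < Real.exp 1 := Real.exp_one_gt_d9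
  have h22 : Real.exp 2 = Real.exp 1 * Real.exp 1 := by rw [← Real.exp_add]; norm_num
  have h3 : Real.exp 3 = Real.exp 1 * Real.exp 1 * Real.exp 1 := by rw [← Real.exp_add, ← Real.exp_add]; norm_num
  have hinv1 : Real.exp (-1) ≤ 5 / 7 := by
    rw [Real.exp_neg, inv_le_comm₀ (Real.exp_pos _) (by norm_num)]
    norm_num; linarith
  have hinv2 : 5 * Real.exp (-2) ≤ 5 / 7 := by
    have h7 : Real.exp (-2) ≤ 1 / 7 := by
      rw [Real.exp_neg, inv_le_comm₀ (Real.exp_pos _) (by norm_num), one_div, inv_inv, h22]; nlinarith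
    linarith
  have hinv3 : Real.exp (-3) ≤ 1 / 8 := by
    rw [Real.exp_neg, inv_le_comm₀ (Real.exp_pos _) (by norm_num), one_div, inv_inv, h3]
    have h4 : (4 : ℝ) ≤ Real.exp 1 * Real.exp 1 := by nlinarith
    nlinarith
  have hT1 : (L : ℝ) * Real.exp (-(8 * (5 / 4 : ℝ) ^ L)) ≤ (5 / 7 : ℝ) ^ L := by
    have hB : 1 + (L : ℝ) * (1 / 4) ≤ (5 / 4 : ℝ) ^ L := by
      rw [show (5 / 4 : ℝ) = 1 + 1 / 4 by norm_num]
      exact one_add_mul_le_pow (by norm_num) L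
    have hE : Real.exp (-(8 * (5 / 4 : ℝ) ^ L)) ≤ Real.exp (-(L : ℝ)) * Real.exp (-(L : ℝ)) := by
      rw [← Real.exp_add]; exact Real.exp_le_exp.2 (by linarith)
    have hL1 : (L : ℝ) * Real.exp (-(L : ℝ)) ≤ 1 := by
      have h := Real.add_one_le_exp (L : ℝ)
      rw [Real.exp_neg, mul_inv_le_iff₀ (Real.exp_pos _)]
      linarith
    have hL2 : Real.exp (-(L : ℝ)) ≤ (5 / 7 : ℝ) ^ L := by
      rw [show (-(L : ℝ)) = L * (-1) by ring, Real.exp_nat_mul]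
      exact pow_le_pow_left₀ (Real.exp_pos _).le hinv1 L
    calc (L : ℝ) * Real.exp (-(8 * (5 / 4 : ℝ) ^ L)) ≤ L * (Real.exp (-(L : ℝ)) * Real.exp (-(L : ℝ))) := by gcongr
      _ = (L * Real.exp (-(L : ℝ))) * Real.exp (-(L : ℝ)) := by ring
      _ ≤ 1 * (5 / 7 : ℝ) ^ L := mul_le_mul hL1 hL2 (Real.exp_pos _).le zero_le_one
      _ = (5 / 7 : ℝ) ^ L := one_mul _
  have hT2 : 5 * Real.exp (-3) * (5 * Real.exp (-2)) ^ L ≤ (5 / 7 : ℝ) ^ L := by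
    have hpow : (5 * Real.exp (-2)) ^ L ≤ (5 / 7 : ℝ) ^ L := pow_le_pow_left₀ (by positivity) hinv2 L
    have hnn : (0 : ℝ) ≤ (5 / 7 : ℝ) ^ L := by positivity
    calc 5 * Real.exp (-3) * (5 * Real.exp (-2)) ^ L ≤ 5 * (1 / 8) * (5 / 7 : ℝ) ^ L :=
          mul_le_mul (by linarith) hpow (by positivity) (by norm_num)
      _ ≤ (5 / 7 : ℝ) ^ L := by linarith
  linarith

/-! ### §3 Probability: pattern counting and the heavy-pattern law of large numbers -/

section Probability

variable {Ω : Type} [MeasurableSpace Ω] (P : Measure Ω) (X : ℕ → Ω → ℝ) (K : ℕ) (y₀ c₀ : ℝ)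

/-- **Pattern counting.** Under the pattern-cost hypothesis, for `n ≠ 0` the event "at least `n` blocks are
`m`-heavy" (`#{j : Fin K | y₀ 2^m < X j} ≥ n`) lies in the union over the `C(K,n)` subsets `S` of size `n` of
the pattern events `{∀ j ∈ S, y₀ 2^m < X j}`, so its probability is `≤ C(K,n) exp (-(c₀+2m) n)`. -/
theorem measure_heavyCount_ge_le
    (hpat : ∀ m : ℕ, ∀ S : Finset (Fin K), S.Nonempty →
      P {ω | ∀ j ∈ S, y₀ * 2 ^ m < X j ω} ≤ ENNReal.ofReal (Real.exp (-((c₀ + 2 * m) * S.card))))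
    (m n : ℕ) (hn : n ≠ 0) :
    P {ω | n ≤ (Finset.univ.filter fun j : Fin K => y₀ * 2 ^ m < X j ω).card}
      ≤ ENNReal.ofReal ((K.choose n : ℝ) * Real.exp (-((c₀ + 2 * m) * n))) := by
  have hsub : {ω | n ≤ (Finset.univ.filter fun j : Fin K => y₀ * 2 ^ m < X j ω).card}
      ⊆ ⋃ S ∈ (Finset.univ : Finset (Fin K)).powersetCard n, {ω | ∀ j ∈ S, y₀ * 2 ^ m < X j ω} := by
    intro ω hω
    have hω' : n ≤ (Finset.univ.filter fun j : Fin K => y₀ * 2 ^ m < X j ω).card := hω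
    obtain ⟨S, hS, hcard⟩ := Finset.exists_subset_card_eq hω'
    simp only [Set.mem_iUnion, Set.mem_setOf_eq]
    exact ⟨S, Finset.mem_powersetCard.2 ⟨Finset.subset_univ _, hcard⟩, fun j hj => (Finset.mem_filter.1 (hS hj)).2⟩
  calc P {ω | n ≤ (Finset.univ.filter fun j : Fin K => y₀ * 2 ^ m < X j ω).card}
      ≤ P (⋃ S ∈ (Finset.univ : Finset (Fin K)).powersetCard n, {ω | ∀ j ∈ S, y₀ * 2 ^ m < X j ω}) := measure_mono hsub
    _ ≤ ∑ S ∈ (Finset.univ : Finset (Fin K)).powersetCard n, P {ω | ∀ j ∈ S, y₀ * 2 ^ m < X j ω} :=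
        measure_biUnion_finset_le _ _
    _ ≤ ∑ S ∈ (Finset.univ : Finset (Fin K)).powersetCard n, ENNReal.ofReal (Real.exp (-((c₀ + 2 * m) * n))) := by
        refine Finset.sum_le_sum fun S hS => ?_
        have hcd : S.card = n := (Finset.mem_powersetCard.1 hS).2
        have hne : S.Nonempty := by rw [← Finset.card_pos, hcd]; exact Nat.pos_of_ne_zero hn
        have := hpat m S hne
        rwa [hcd] at this
    _ = ENNReal.ofReal ((K.choose n : ℝ) * Real.exp (-((c₀ + 2 * m) * n))) := by
        rw [Finset.sum_const, Finset.card_powersetCard, Finset.card_univ, Fintype.card_fin,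
          nsmul_eq_mul, ENNReal.ofReal_mul (Nat.cast_nonneg _), ENNReal.ofReal_natCast]

/-- **Heavy-pattern law of large numbers.** Under the pattern-cost hypothesis with `c₀ ≥ 3`, for `K ≠ 0`,
nonnegative blocks and `y₀ > 0`: `P (8 y₀ < K⁻¹ Σ_{j<K} X j) ≤ 2 (5/7)^{⌊log_5 K⌋}`.  The bad event is covered
by `⋃_{m<L} {#_m ≥ K/4^m + 1} ∪ {#_L ≥ 1}` (`sum_le_of_counts`, `L = ⌊log_5 K⌋`), each piece is priced by
`measure_heavyCount_ge_le` + `choose_mul_exp_le`, and `rate_bound` sums up. -/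
theorem measure_avg_gt_le (hc : 3 ≤ c₀) (hy : 0 < y₀) (hK : K ≠ 0) (hXnn : ∀ j ω, 0 ≤ X j ω)
    (hpat : ∀ m : ℕ, ∀ S : Finset (Fin K), S.Nonempty →
      P {ω | ∀ j ∈ S, y₀ * 2 ^ m < X j ω} ≤ ENNReal.ofReal (Real.exp (-((c₀ + 2 * m) * S.card)))) :
    P {ω | 8 * y₀ < (K : ℝ)⁻¹ * ∑ j ∈ Finset.range K, X j ω} ≤ ENNReal.ofReal (2 * (5 / 7 : ℝ) ^ Nat.log 5 K) := by
  set L : ℕ := Nat.log 5 K with hL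
  have hKL : 5 ^ L ≤ K := Nat.pow_log_le_self 5 hK
  have hKL' : K < 5 ^ (L + 1) := Nat.lt_pow_succ_log_self (by norm_num) K
  set N : ℕ → Ω → ℕ := fun m ω => (Finset.univ.filter fun j : Fin K => y₀ * 2 ^ m < X j ω).card with hN
  -- (A) the bad event is covered by finitely many heavy-count events
  have hsub : {ω | 8 * y₀ < (K : ℝ)⁻¹ * ∑ j ∈ Finset.range K, X j ω}
      ⊆ (⋃ m ∈ Finset.range L, {ω | K / 4 ^ m + 1 ≤ N m ω}) ∪ {ω | 1 ≤ N L ω} := by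
    intro ω hω
    have hω' : 8 * y₀ < (K : ℝ)⁻¹ * ∑ j ∈ Finset.range K, X j ω := hω
    by_contra hcon
    have h1 : ∀ m, m < L → N m ω < K / 4 ^ m + 1 := fun m hm => not_le.1 fun h' =>
      hcon (Set.mem_union_left _ (Set.mem_iUnion.2 ⟨m, Set.mem_iUnion.2 ⟨Finset.mem_range.2 hm, h'⟩⟩))
    have h2 : N L ω < 1 := not_le.1 fun h' => hcon (Set.mem_union_right _ h')
    have hall : ∀ m : ℕ, N m ω ≤ K / 4 ^ m := by
      intro m
      by_cases hm : m < L
      · exact Nat.lt_succ_iff.1 (h1 m hm)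
      · have hmono : N m ω ≤ N L ω := by
          refine Finset.card_le_card fun j hj => ?_
          simp only [Finset.mem_filter, Finset.mem_univ, true_and] at hj ⊢
          exact lt_of_le_of_lt (mul_le_mul_of_nonneg_left (pow_le_pow_right₀ one_le_two (not_lt.1 hm)) hy.le) hj
        exact (hmono.trans (Nat.lt_one_iff.1 h2).le).trans (Nat.zero_le _)
    have hsum : ∑ j : Fin K, X j ω ≤ 3 * K * y₀ := sum_le_of_counts hy (fun j : Fin K => X j ω) (fun j => hXnn j ω) hall
    rw [Fin.sum_univ_eq_sum_range (fun j => X j ω) K] at hsum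
    have hKpos : (0 : ℝ) < K := by positivity
    rw [← div_eq_inv_mul, lt_div_iff₀ hKpos] at hω'
    nlinarith [mul_pos hy hKpos]
  -- (B) price of the pieces
  have hb : ∀ m ∈ Finset.range L, P {ω | K / 4 ^ m + 1 ≤ N m ω} ≤ ENNReal.ofReal (Real.exp (-(8 * (5 / 4 : ℝ) ^ L))) := by
    intro m hm
    have hmL : m + 1 ≤ L := Finset.mem_range.1 hm
    set n : ℕ := K / 4 ^ m + 1 with hn
    have hn0 : n ≠ 0 := Nat.succ_ne_zero _
    have hKn_nat : K < 4 ^ m * n := Nat.lt_mul_div_succ K (pow_pos (by norm_num) m)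
    have hKn : (K : ℝ) ≤ 4 ^ m * n := by exact_mod_cast hKn_nat.le
    have hgrow : 4 * (5 / 4 : ℝ) ^ L ≤ n := by
      have h1 : 4 ^ m * (4 * 5 ^ L) ≤ 4 ^ m * (4 ^ L * n) :=
        calc 4 ^ m * (4 * 5 ^ L) = 4 ^ (m + 1) * 5 ^ L := by ring
          _ ≤ 4 ^ L * K := Nat.mul_le_mul (Nat.pow_le_pow_right (by norm_num) hmL) hKL
          _ ≤ 4 ^ L * (4 ^ m * n) := Nat.mul_le_mul_left _ hKn_nat.le
          _ = 4 ^ m * (4 ^ L * n) := by ring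
      have h3 : (4 : ℝ) * 5 ^ L ≤ 4 ^ L * n := by exact_mod_cast Nat.le_of_mul_le_mul_left h1 (pow_pos (by norm_num) m)
      rw [div_pow, ← mul_div_assoc, div_le_iff₀ (by positivity)]
      exact h3.trans_eq (mul_comm _ _)
    calc P {ω | n ≤ N m ω} ≤ ENNReal.ofReal ((K.choose n : ℝ) * Real.exp (-((c₀ + 2 * m) * n))) :=
          measure_heavyCount_ge_le P X K y₀ c₀ hpat m n hn0
      _ ≤ ENNReal.ofReal (Real.exp (-(2 * n))) := ENNReal.ofReal_le_ofReal (choose_mul_exp_le hc K n m hn0 hKn)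
      _ ≤ ENNReal.ofReal (Real.exp (-(8 * (5 / 4 : ℝ) ^ L))) := ENNReal.ofReal_le_ofReal (Real.exp_le_exp.2 (by linarith))
  have ha : P {ω | 1 ≤ N L ω} ≤ ENNReal.ofReal (5 * Real.exp (-3) * (5 * Real.exp (-2)) ^ L) := by
    refine (measure_heavyCount_ge_le P X K y₀ c₀ hpat L 1 one_ne_zero).trans (ENNReal.ofReal_le_ofReal ?_)
    rw [Nat.choose_one_right, Nat.cast_one, mul_one]
    have hK5 : (K : ℝ) ≤ 5 * 5 ^ L := by
      have : K ≤ 5 * 5 ^ L := by rw [← pow_succ']; exact hKL'.le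
      exact_mod_cast this
    have hexp : Real.exp (-(c₀ + 2 * L)) ≤ Real.exp (-3) * Real.exp (-2) ^ L := by
      rw [← Real.exp_nat_mul, ← Real.exp_add]
      exact Real.exp_le_exp.2 (by linarith)
    calc (K : ℝ) * Real.exp (-(c₀ + 2 * L)) ≤ (5 * 5 ^ L) * (Real.exp (-3) * Real.exp (-2) ^ L) :=
          mul_le_mul hK5 hexp (Real.exp_pos _).le (by positivity)
      _ = 5 * Real.exp (-3) * (5 * Real.exp (-2)) ^ L := by rw [mul_pow]; ring
  -- (C) union bound and summation
  calc P {ω | 8 * y₀ < (K : ℝ)⁻¹ * ∑ j ∈ Finset.range K, X j ω}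
      ≤ P ((⋃ m ∈ Finset.range L, {ω | K / 4 ^ m + 1 ≤ N m ω}) ∪ {ω | 1 ≤ N L ω}) := measure_mono hsub
    _ ≤ P (⋃ m ∈ Finset.range L, {ω | K / 4 ^ m + 1 ≤ N m ω}) + P {ω | 1 ≤ N L ω} := measure_union_le _ _
    _ ≤ (∑ m ∈ Finset.range L, ENNReal.ofReal (Real.exp (-(8 * (5 / 4 : ℝ) ^ L))))
          + ENNReal.ofReal (5 * Real.exp (-3) * (5 * Real.exp (-2)) ^ L) :=
        add_le_add ((measure_biUnion_finset_le _ _).trans (Finset.sum_le_sum hb)) ha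
    _ = ENNReal.ofReal (L * Real.exp (-(8 * (5 / 4 : ℝ) ^ L)) + 5 * Real.exp (-3) * (5 * Real.exp (-2)) ^ L) := by
        rw [Finset.sum_const, Finset.card_range, nsmul_eq_mul, ← ENNReal.ofReal_natCast,
          ← ENNReal.ofReal_mul (Nat.cast_nonneg _), ENNReal.ofReal_add (by positivity) (by positivity)]
    _ ≤ ENNReal.ofReal (2 * (5 / 7 : ℝ) ^ L) := ENNReal.ofReal_le_ofReal (rate_bound L)

end Probability

/-! ### §4 The engine -/

/-- **Pattern-cost ⇒ LLN engine** (stub `stub_patternCostEngine` of the line `Sketch`, card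
heavy-block-pattern-cost).  For `c₀ ≥ 3` and `η > 0` there is `K₀ = K₀(c₀, η)` such that for every `K ≥ K₀`,
every probability space, every family of nonnegative measurable blocks `X j`, every `y₀ > 0`, `M' ≥ 0`,
`δ' ≥ 0`: if every nonempty temporal pattern `S ⊆ Fin K` of `m`-heavy blocks costs `P ≤ exp (-(c₀ + 2m)|S|)`
and `Σ_{j<K} E (X j - M')₊ ≤ K δ'`, then `E[ā 𝟙{ā > 8 y₀}] ≤ M' η + δ'` for `ā = K⁻¹ Σ_{j<K} X j`.
Proof: `ā 𝟙{ā > 8y₀} ≤ M' 𝟙{ā > 8y₀} + K⁻¹ Σ_j (X j - M')₊` pointwise, `P (ā > 8 y₀) ≤ 2 (5/7)^{⌊log_5 K⌋} ≤ η`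
(`measure_avg_gt_le`; `K₀ = 5^{m₀}` with `(5/7)^{m₀} < η/2`), and integrate. -/
theorem stub_patternCostEngine :
    ∀ c₀ η : ℝ, 3 ≤ c₀ → 0 < η → ∃ K₀ : ℕ, ∀ K : ℕ, K₀ ≤ K →
    ∀ (Ω : Type) [MeasurableSpace Ω] (P : Measure Ω) [IsProbabilityMeasure P] (X : ℕ → Ω → ℝ) (y₀ M' δ' : ℝ),
      (∀ j, Measurable (X j)) → (∀ j ω, 0 ≤ X j ω) → 0 < y₀ → 0 ≤ M' → 0 ≤ δ' →
      (∀ m : ℕ, ∀ S : Finset (Fin K), S.Nonempty →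
        P {ω | ∀ j ∈ S, y₀ * 2 ^ m < X j ω} ≤ ENNReal.ofReal (Real.exp (-((c₀ + 2 * m) * S.card)))) →
      (∑ j ∈ Finset.range K, ∫⁻ ω, ENNReal.ofReal (X j ω - M') ∂P ≤ ENNReal.ofReal (K * δ')) →
      ∫⁻ ω, ENNReal.ofReal (Set.indicator {y : ℝ | 8 * y₀ < y} (fun y => y)
          ((K : ℝ)⁻¹ * ∑ j ∈ Finset.range K, X j ω)) ∂P ≤ ENNReal.ofReal (M' * η + δ') := by
  intro c₀ η hc hη
  obtain ⟨m₀, hm₀⟩ := exists_pow_lt_of_lt_one (half_pos hη) (by norm_num : (5 / 7 : ℝ) < 1)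
  refine ⟨5 ^ m₀, fun K hK Ω _ P _ X y₀ M' δ' hXm hXnn hy hM' hδ' hpat hmom => ?_⟩
  have hK0 : K ≠ 0 := (lt_of_lt_of_le (pow_pos (by norm_num) m₀) hK).ne'
  have hKpos : (0 : ℝ) < K := by positivity
  -- the bad event and its probability
  set A : Set Ω := {ω | 8 * y₀ < (K : ℝ)⁻¹ * ∑ j ∈ Finset.range K, X j ω} with hA
  have hAmeas : MeasurableSet A :=
    measurableSet_lt measurable_const (measurable_const.mul (Finset.measurable_sum _ fun j _ => hXm j))
  have hPA : P A ≤ ENNReal.ofReal η := by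
    refine (measure_avg_gt_le P X K y₀ c₀ hc hy hK0 hXnn hpat).trans (ENNReal.ofReal_le_ofReal ?_)
    have : (5 / 7 : ℝ) ^ Nat.log 5 K ≤ (5 / 7 : ℝ) ^ m₀ :=
      pow_le_pow_of_le_one (by norm_num) (by norm_num) (Nat.le_log_of_pow_le (by norm_num) hK)
    linarith
  -- pointwise domination of the integrand
  have hpt : ∀ ω, ENNReal.ofReal (Set.indicator {y : ℝ | 8 * y₀ < y} (fun y => y) ((K : ℝ)⁻¹ * ∑ j ∈ Finset.range K, X j ω))
      ≤ A.indicator (fun _ => ENNReal.ofReal M') ω + ENNReal.ofReal ((K : ℝ)⁻¹) * ∑ j ∈ Finset.range K, ENNReal.ofReal (X j ω - M') := by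
    intro ω
    by_cases hω : ω ∈ A
    · have hω' : (K : ℝ)⁻¹ * ∑ j ∈ Finset.range K, X j ω ∈ {y : ℝ | 8 * y₀ < y} := hω
      rw [Set.indicator_of_mem hω', Set.indicator_of_mem hω]
      have hs : ∑ j ∈ Finset.range K, X j ω ≤ ∑ j ∈ Finset.range K, (M' + max (X j ω - M') 0) :=
        Finset.sum_le_sum fun j _ => by linarith [le_max_left (X j ω - M') 0]
      rw [Finset.sum_add_distrib, Finset.sum_const, Finset.card_range, nsmul_eq_mul] at hs
      have hKinv : (K : ℝ)⁻¹ * (K * M') = M' := by rw [← mul_assoc, inv_mul_cancel₀ hKpos.ne', one_mul]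
      have key : (K : ℝ)⁻¹ * ∑ j ∈ Finset.range K, X j ω ≤ M' + (K : ℝ)⁻¹ * ∑ j ∈ Finset.range K, max (X j ω - M') 0 :=
        calc (K : ℝ)⁻¹ * ∑ j ∈ Finset.range K, X j ω ≤ (K : ℝ)⁻¹ * (K * M' + ∑ j ∈ Finset.range K, max (X j ω - M') 0) :=
              mul_le_mul_of_nonneg_left hs (inv_nonneg.2 hKpos.le)
          _ = M' + (K : ℝ)⁻¹ * ∑ j ∈ Finset.range K, max (X j ω - M') 0 := by rw [mul_add, hKinv]
      calc ENNReal.ofReal ((fun y : ℝ => y) ((K : ℝ)⁻¹ * ∑ j ∈ Finset.range K, X j ω))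
          ≤ ENNReal.ofReal (M' + (K : ℝ)⁻¹ * ∑ j ∈ Finset.range K, max (X j ω - M') 0) := ENNReal.ofReal_le_ofReal key
        _ ≤ ENNReal.ofReal M' + ENNReal.ofReal ((K : ℝ)⁻¹ * ∑ j ∈ Finset.range K, max (X j ω - M') 0) :=
            ENNReal.ofReal_add_le
        _ = (fun _ => ENNReal.ofReal M') ω + ENNReal.ofReal ((K : ℝ)⁻¹) * ∑ j ∈ Finset.range K, ENNReal.ofReal (X j ω - M') := by
            have hmax : ∀ x : ℝ, ENNReal.ofReal (max x 0) = ENNReal.ofReal x := fun x => by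
              rcases le_total x 0 with h | h
              · rw [max_eq_right h, ENNReal.ofReal_zero, ENNReal.ofReal_of_nonpos h]
              · rw [max_eq_left h]
            rw [ENNReal.ofReal_mul (inv_nonneg.2 hKpos.le), ENNReal.ofReal_sum_of_nonneg (fun j _ => le_max_right _ _)]
            simp_rw [hmax]
    · have hω' : (K : ℝ)⁻¹ * ∑ j ∈ Finset.range K, X j ω ∉ {y : ℝ | 8 * y₀ < y} := hω
      rw [Set.indicator_of_notMem hω', Set.indicator_of_notMem hω, ENNReal.ofReal_zero]
      exact zero_le
  have hmeas_f : ∀ j, Measurable fun ω => ENNReal.ofReal (X j ω - M') := fun j => ((hXm j).sub_const M').ennreal_ofReal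
  -- integrate
  calc ∫⁻ ω, ENNReal.ofReal (Set.indicator {y : ℝ | 8 * y₀ < y} (fun y => y) ((K : ℝ)⁻¹ * ∑ j ∈ Finset.range K, X j ω)) ∂P
      ≤ ∫⁻ ω, (A.indicator (fun _ => ENNReal.ofReal M') ω
          + ENNReal.ofReal ((K : ℝ)⁻¹) * ∑ j ∈ Finset.range K, ENNReal.ofReal (X j ω - M')) ∂P := lintegral_mono hpt
    _ = ENNReal.ofReal M' * P A + ENNReal.ofReal ((K : ℝ)⁻¹) * ∑ j ∈ Finset.range K, ∫⁻ ω, ENNReal.ofReal (X j ω - M') ∂P := by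
        rw [lintegral_add_left ((measurable_const (a := ENNReal.ofReal M')).indicator hAmeas), lintegral_indicator_const hAmeas,
          lintegral_const_mul _ (Finset.measurable_sum _ fun j _ => hmeas_f j), lintegral_finsetSum _ fun j _ => hmeas_f j]
    _ ≤ ENNReal.ofReal M' * ENNReal.ofReal η + ENNReal.ofReal ((K : ℝ)⁻¹) * ENNReal.ofReal (K * δ') := by gcongr
    _ = ENNReal.ofReal (M' * η + δ') := by
        rw [← ENNReal.ofReal_mul hM', ← ENNReal.ofReal_mul (inv_nonneg.2 hKpos.le),
          ← ENNReal.ofReal_add (mul_nonneg hM' hη.le) (mul_nonneg (inv_nonneg.2 hKpos.le) (mul_nonneg hKpos.le hδ'))]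
        congr 1
        rw [← mul_assoc, inv_mul_cancel₀ hKpos.ne', one_mul]

end Summit.AtomisticToContinuum.HydrodynamicLimit.Theorems.TransferActivityTailsPatternCostEngine

end
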